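import Literature.NumberTheory.EllipticCurves.TwoDescentOneRootH1Injective
import Literature.GroupTheory.KleinFourTransfer
import Mathlib.RingTheory.Norm.Transitivity
import Mathlib.FieldTheory.PrimitiveElement
import HarnessLib

/-!
# The norm condition of the general `2`-descent: `N_{K/k}(Φ(c)) ∈ kˣ²` for EVERY `c ∈ H¹(k, E[2])`
# (Cassels, *Lectures on Elliptic Curves*, §15: `Norm(a − Θ) = F(a) ∈ k*²`, lifted from points to `H¹`)

Setting of `TwoDescentOneRootH1Injective.lean`: an elliptic curve `E/k` (`char k = 0`) with IRREDUCIBLE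
`2`-division cubic, an extension `K/k` of degree `3` with a root `θ ∈ K` (`K = k(θ)`), and the cohomological
Cassels map `Φ = kummerEquiv K 2 ∘ oneRootDescentH1 K hθ : H¹(k, E[2]) → H¹(K, μ₂) ≃ Kˣ/Kˣ²` (restriction to
`K`, the character `χ_θ` of `T_θ`, Kummer theory). Main theorem **`isSquare_norm_of_kummerEquiv_oneRootDescentH1_eq`**:

  if `Φ(c) = [a]` with `a ∈ Kˣ`, then `N_{K/k}(a)` is a square in `k`.

For Kummer classes of rational points this is Cassels' `Norm(x − Θ) = F(x) = ỹ²` (tree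
`casselsMap_norm_relation`); for a general class it is the statement that the image of `H¹(k, E[2])` in
`Kˣ/Kˣ²` lies in the kernel of the norm to `kˣ/kˣ²` (Schaefer–Stoll: `H¹(k, E[2]) ≅ ker(N : Kˣ/Kˣ² → kˣ/kˣ²)`
for irreducible `E[2]`), i.e. `cor_{K/k} ∘ H¹(χ_θ) ∘ res_{K/k} = 0` on `H¹(k, E[2])` read through Kummer theory
(`cor` on `H¹(·, μ₂)` is the norm). Proof, inside `Γ_k` with `N = Gal(k̄/K) = galRange K` (the stabiliser of
`T_θ`, `smul_geomOneRootOverTorsion_eq_iff`) and coset representatives `s`: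

* (`exists_sign_eq_smul_div`) unwinding `Φ(c) = [a]`: for a cocycle `ξ` of `c` and `β ∈ k̄` with `β² = j(a)`
  (`j : K → k̄` the copy of `K` fixed by `N`, `closureCopy`), **`χ_{T_θ}(ξ(h)) = h(β)/β` for all `h ∈ N`** — the
  cocycle `χ_θ ∘ ξ|_{Γ_K}` IS the Kummer cocycle of `√a` (the coboundary ambiguity is trivial: `Γ_K` fixes `±1`);
  transported from `K̄` to `k̄` along the tree's `algEquivOfEmb K (closureEmb K) : k̄ ≃ K̄`;
* (`Literature.GroupTheory.KleinCocycle.prod_sign_apply_schreier_eq_one`) the transfer of `χ_{T_θ} ∘ ξ|_N`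
  vanishes: `∏ₓ χ_{T_θ}(ξ(s(gx)⁻¹ g s(x))) = 1`;
* hence (`prod_smul_div_eq`) `g(A) = A` for `A = ∏ₓ s(x)(β)`, so `A ∈ k` (`K̄^{Γ_k} = k`), and
  `A² = ∏ₓ s(x)(j a) = ∏_{σ : K → k̄} σ(a) = N_{K/k}(a)` (`prod_quotient_galRange_eq_prod_algHom`: the cosets of
  `N` are the `k`-embeddings of `K`, `x ↦ s(x) ∘ j`; Mathlib `Algebra.norm_eq_prod_embeddings`).

Consumer: the `2`-Selmer upgrade of the kernel general `2`-descent certificates (the sieve clause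
"`N(class)` is a rational square", `admStd`/`admStd3R`, now holds for every Selmer class, not only for rational
points); together with the per-place sign conditions it yields the joint real condition at the three real places
of a totally real cubic field (`sign ρ₂ = sign ρ₃` from `N(a) > 0`). Theorems only; no named fact, no `sorry`.
Seat `bsd-line-spt-p1` (g29), milestone S5(ii).

## References

* [Cassels1991LecturesEllipticCurves] J. W. S. Cassels, *Lectures on Elliptic Curves*, LMSST 24, CUP 1991, §15
  (pp. 42–44: `Norm(a − Θ) = F(a)`, hence `μ(𝔊) ⊆ ker Norm`).
* [SchaeferStoll2004] E. F. Schaefer, M. Stoll, *How to do a p-descent on an elliptic curve*, Trans. AMS 356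
  (2004), Lemma 3.1 / §5 (`H¹(k, E[2]) ≅ ker(N : A×/A×² → k×/k×²)`).
* [NeukirchSchmidtWingberg2008] J. Neukirch, A. Schmidt, K. Wingberg, *Cohomology of Number Fields* (2008), I §5
  (`cor` in degree `0`/`1` and the norm).
* [SerreGaloisCohomology1997] J.-P. Serre, *Galois Cohomology*, Springer 1997, I.§2.4, II.§1.2.
-/

noncomputable section

open scoped Classical

universe u

namespace WeierstrassCurve

open Literature Literature.NumberTheory.GaloisRepresentations Literature.NumberTheory.EllipticCurves Field
open WeierstrassCurve.Affine Polynomial Literature.GroupTheory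

variable {k : Type u} [Field k] [CharZero k] (W : WeierstrassCurve k) [W.IsElliptic]
  {K : Type u} [Field K] [Algebra k K] [Algebra.IsAlgebraic k K] {θ : K}

/-! ## Transport between `K̄` and `k̄` along the chosen isomorphism -/

omit [CharZero k] [W.IsElliptic] in
/-- **`Γ_K` acts on `k̄` through `resGal` and the chosen isomorphism `Ψ : k̄ ≃ K̄`**:
`(resGal τ)(Ψ⁻¹ y) = Ψ⁻¹(τ y)` (`Ψ = algEquivOfEmb K (closureEmb K)`; `closureEmb ∘ resGal τ = τ ∘ closureEmb`).
[cite: SerreGaloisCohomology1997, II.§1.1] -/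
theorem resGal_smul_symm_apply (τ : absoluteGaloisGroup K) (y : AlgebraicClosure K) :
    resGal (K := k) K τ • (algEquivOfEmb K (closureEmb (K := k) K)).symm y =
      (algEquivOfEmb K (closureEmb (K := k) K)).symm (τ • y) := by
  set Ψ := algEquivOfEmb K (closureEmb (K := k) K) with hΨ
  apply Ψ.injective
  rw [AlgEquiv.apply_symm_apply]
  have h2 : absClosureEmbedding k K (Ψ.symm y) = y := Ψ.apply_symm_apply y
  have h := absGaloisRestrict_apply_smul k K τ (Ψ.symm y)
  rw [h2] at h
  exact h

/-! ## Unwinding `Φ(c) = [a]`: the cocycle `χ_θ ∘ ξ` on `Gal(k̄/K)` is the Kummer cocycle of `√a` -/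

omit [CharZero k] [W.IsElliptic] [Algebra.IsAlgebraic k K] in
/-- **`χ_θ(ξ(τ)) = τ(α)/α` on `Γ_K`** (`α = ²√a ∈ K̄` the tree's chosen root): if
`kummerEquiv K 2 (Φ(c)) = [a]` for the class `c = [ξ]`, then for every `τ ∈ Γ_K` the value of the character of
`T_θ` on `ξ(τ|_k̄)` (read in `K̄ˣ`) is `τ(α)/α` — the two cocycles are cohomologous in `H¹(K, μ₂)` and `Γ_K`
fixes `±1`. [cite: Cassels1991LecturesEllipticCurves, §15 (μ)] [cite: SerreGaloisCohomology1997, II.§1.2] -/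
theorem muVal_oneRootChar_resTorsion_eq [CharZero K] [(W.baseChange K).IsElliptic]
    (hθ : (W.baseChange K).toAffine.IsTwoTorsionX θ)
    (ξ : contOneCocycles (discreteTopRep (absoluteGaloisGroup k) (geomTorsion W 2))) (a : Kˣ)
    (ha : kummerEquiv K 2 (W.oneRootDescentH1 K hθ (oneCocycleClass _ ξ)) =
      Additive.ofMul (QuotientGroup.mk a)) (τ : absoluteGaloisGroup K) :
    muVal K 2 ((W.baseChange K).oneRootChar hθ (torsionBaseChangeMap W K 2 (ξ.1 (resGal (K := k) K τ)))) =
      τ • ((kummerUnitsRoot K 2 a : kummerUnits K 2) : (AlgebraicClosure K)ˣ) /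
        ((kummerUnitsRoot K 2 a : kummerUnits K 2) : (AlgebraicClosure K)ˣ) := by
  -- the class of `χ_θ ∘ tbc ∘ ξ ∘ resGal` is the Kummer class of `a`
  have hclass : (W.baseChange K).oneRootCharH1 hθ (resTorsion W K 2 (oneCocycleClass _ ξ)) =
      (kummerMap K 2 a).toAdd := by
    apply (kummerEquiv K 2).injective
    rw [kummerEquiv_kummerMap, ← oneRootDescentH1_apply, ha]
  rw [resTorsion_oneCocycleClass, oneRootCharH1_oneCocycleClass, kummerMap_apply, kummerClassHom_apply,
    toAdd_ofAdd, ← sub_eq_zero, ← oneCocycleClass_sub, oneCocycleClass_eq_zero_iff] at hclass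
  obtain ⟨v, hv⟩ := hclass
  have hτ := hv τ
  rw [Submodule.coe_sub, ContinuousMap.sub_apply, sub_eq_iff_eq_add] at hτ
  have htriv : (DiscreteGaloisModule.mu K 2).toTopRep.ρ τ v - v = 0 := by
    change DiscreteGaloisModule.mu K 2 τ v - v = 0
    rw [mu_two_apply_eq, sub_self]
  rw [htriv, zero_add, contOneCocycles.pullback_apply, contOneCocycles.pullback_apply,
    kummerOneCocycle_apply] at hτ
  have hτ' : (W.baseChange K).oneRootChar hθ (torsionBaseChangeMap W K 2 (ξ.1 (resGal (K := k) K τ))) =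
      kummerOneCocycleFun K 2 (kummerUnitsRoot K 2 a) τ := hτ
  rw [hτ', muVal_kummerOneCocycleFun]

/-- **The sign `χ_{T_θ}(ξ(h))` on `N = galRange K` is the Kummer cocycle of `β = Ψ⁻¹(√a) ∈ k̄`**: for
`h ∈ galRange K`, `χ_{T_θ}(ξ(h)) = h(β)/β` with `β² = j(a)` — statement (E2) of the file docstring, the
transport of `muVal_oneRootChar_resTorsion_eq` along `Ψ : k̄ ≃ K̄` (`T_θ ↦ T_θ`, `torsionBaseChangeMap`
injective). [cite: Cassels1991LecturesEllipticCurves, §15 (μ)] [cite: SerreGaloisCohomology1997, II.§1.1–1.2] -/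
theorem sign_apply_eq_smul_div [CharZero K] [(W.baseChange K).IsElliptic]
    (hθ : (W.baseChange K).toAffine.IsTwoTorsionX θ)
    (ξ : contOneCocycles (discreteTopRep (absoluteGaloisGroup k) (geomTorsion W 2))) (a : Kˣ)
    (ha : kummerEquiv K 2 (W.oneRootDescentH1 K hθ (oneCocycleClass _ ξ)) =
      Additive.ofMul (QuotientGroup.mk a)) {h : absoluteGaloisGroup k} (hh : h ∈ galRange (K := k) K) :
    (if ξ.1 h = 0 ∨ ξ.1 h = W.geomOneRootOverTorsion hθ then (1 : AlgebraicClosure k) else -1) =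
      h • (algEquivOfEmb K (closureEmb (K := k) K)).symm
          (((kummerUnitsRoot K 2 a : kummerUnits K 2) : (AlgebraicClosure K)ˣ) : AlgebraicClosure K) /
        (algEquivOfEmb K (closureEmb (K := k) K)).symm
          (((kummerUnitsRoot K 2 a : kummerUnits K 2) : (AlgebraicClosure K)ˣ) : AlgebraicClosure K) := by
  obtain ⟨τ, hτ⟩ := hh
  have hτ' : resGal (K := k) K τ = h := hτ
  subst hτ'
  set Ψ := algEquivOfEmb K (closureEmb (K := k) K) with hΨ
  set α : (AlgebraicClosure K)ˣ := ((kummerUnitsRoot K 2 a : kummerUnits K 2) : (AlgebraicClosure K)ˣ)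
  have hE1 := W.muVal_oneRootChar_resTorsion_eq hθ ξ a ha τ
  rw [oneRootChar_apply, muVal_oneRootCharFun] at hE1
  -- the conditions agree across `torsionBaseChangeMap` (injective, `T_θ ↦ T_θ`)
  have hcond : (ξ.1 (resGal (K := k) K τ) = 0 ∨ ξ.1 (resGal (K := k) K τ) = W.geomOneRootOverTorsion hθ) ↔
      (((torsionBaseChangeMap W K 2 (ξ.1 (resGal (K := k) K τ)) : geomTorsion (W.baseChange K) 2) :
          geomPoints (W.baseChange K)) = 0 ∨
        ((torsionBaseChangeMap W K 2 (ξ.1 (resGal (K := k) K τ)) : geomTorsion (W.baseChange K) 2) :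
          geomPoints (W.baseChange K)) = (W.baseChange K).geomOneRoot hθ) := by
    constructor
    · rintro (h0 | h1)
      · left; rw [h0, map_zero]; rfl
      · right; rw [h1]; exact W.torsionBaseChangeMap_geomOneRootOverTorsion hθ
    · rintro (h0 | h1)
      · left
        apply torsionBaseChangeMap_injective W K 2
        rw [map_zero]
        exact Subtype.ext h0
      · right
        apply torsionBaseChangeMap_injective W K 2
        apply Subtype.ext
        exact h1.trans (W.torsionBaseChangeMap_geomOneRootOverTorsion hθ).symm
  -- transport `τ α / α` to `k̄`
  have hsmul : resGal (K := k) K τ • Ψ.symm (α : AlgebraicClosure K) = Ψ.symm (τ • (α : AlgebraicClosure K)) :=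
    resGal_smul_symm_apply (k := k) τ _
  rw [hsmul, ← map_div₀]
  have hunits : τ • (α : AlgebraicClosure K) / (α : AlgebraicClosure K) = ((τ • α / α : (AlgebraicClosure K)ˣ) :
      AlgebraicClosure K) := by
    rw [Units.val_div_eq_div_val, Units.coe_smul]
  rw [hunits, ← hE1]
  by_cases hc : ξ.1 (resGal (K := k) K τ) = 0 ∨ ξ.1 (resGal (K := k) K τ) = W.geomOneRootOverTorsion hθ
  · rw [if_pos hc, if_pos (hcond.mp hc), Units.val_one, map_one]
  · rw [if_neg hc, if_neg (fun h' => hc (hcond.mpr h')), Units.val_neg, Units.val_one, map_neg, map_one]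

/-! ## The cosets of `N = galRange K` are the `k`-embeddings of `K` -/

omit [CharZero k] [W.IsElliptic] in
/-- The embedding attached to a coset: `x ↦ s(x) ∘ j` is injective on `Γ_k/galRange K` (`galRange K` is the
pointwise fixer of `j(K)`). [cite: SerreGaloisCohomology1997, II.§1.1] -/
theorem algHom_rep_injective {s : absoluteGaloisGroup k ⧸ galRange (K := k) K → absoluteGaloisGroup k}
    (hs : ∀ x, (s x : absoluteGaloisGroup k ⧸ galRange (K := k) K) = x) :
    Function.Injective fun x : absoluteGaloisGroup k ⧸ galRange (K := k) K =>
      ((show AlgebraicClosure k ≃ₐ[k] AlgebraicClosure k from s x) : AlgebraicClosure k →ₐ[k] AlgebraicClosure k).comp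
        (closureCopy K) := by
  intro x y hxy
  have hmem : (s y)⁻¹ * s x ∈ galRange (K := k) K := by
    rw [mem_galRange_iff_forall_closureCopy]
    intro z
    set τx : AlgebraicClosure k ≃ₐ[k] AlgebraicClosure k := s x with hτx
    set τy : AlgebraicClosure k ≃ₐ[k] AlgebraicClosure k := s y with hτy
    have hz0 := congrArg (fun f : K →ₐ[k] AlgebraicClosure k => f z) hxy
    simp only [AlgHom.coe_comp, Function.comp_apply] at hz0
    have hz : τx (closureCopy K z) = τy (closureCopy K z) := hz0
    change (τy⁻¹ * τx) (closureCopy K z) = closureCopy K z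
    rw [AlgEquiv.mul_apply, AlgEquiv.aut_inv, hz, AlgEquiv.symm_apply_apply]
  rw [← hs x, ← hs y]
  exact (QuotientGroup.eq.mpr hmem).symm

/-! ## The main theorem -/

/-- **`N_{K/k}(Φ(c))` is a square for every `c ∈ H¹(k, E[2])`** (Cassels §15 `Norm(a − Θ) ∈ k*²` lifted to
`H¹`; `cor ∘ H¹(χ_θ) ∘ res = 0`): for `E/k` with irreducible `2`-division cubic, `K/k` cubic with a root `θ`,
`c ∈ H¹(k, E[2])` and `a ∈ Kˣ` with `kummerEquiv K 2 (oneRootDescentH1 K hθ c) = [a]`, the norm `N_{K/k}(a)` is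
a square in `k`. [cite: Cassels1991LecturesEllipticCurves, §15 (Norm(a − Θ) = F(a))]
[cite: SchaeferStoll2004, Lemma 3.1] [cite: NeukirchSchmidtWingberg2008, Ch. I §5] -/
theorem isSquare_norm_of_kummerEquiv_oneRootDescentH1_eq [CharZero K] [(W.baseChange K).IsElliptic]
    (hirr : Irreducible (X ^ 3 + C (W.b₂ / 4) * X ^ 2 + C (W.b₄ / 2) * X + C (W.b₆ / 4) : k[X]))
    (h3 : Module.finrank k K = 3) (hθ : (W.baseChange K).toAffine.IsTwoTorsionX θ)
    (c : galH1Torsion W 2) (a : Kˣ)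
    (ha : kummerEquiv K 2 (W.oneRootDescentH1 K hθ c) = Additive.ofMul (QuotientGroup.mk a)) :
    IsSquare (Algebra.norm k (a : K)) := by
  obtain ⟨ξ, rfl⟩ := oneCocycleClass_surjective _ c
  haveI : FiniteDimensional k K := Module.finite_of_finrank_eq_succ h3
  -- notation
  set G := absoluteGaloisGroup k
  set N : Subgroup (absoluteGaloisGroup k) := galRange (K := k) K with hNdef
  set Ψ := algEquivOfEmb K (closureEmb (K := k) K) with hΨ
  set α : (AlgebraicClosure K)ˣ := ((kummerUnitsRoot K 2 a : kummerUnits K 2) : (AlgebraicClosure K)ˣ) with hα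
  set β : AlgebraicClosure k := Ψ.symm (α : AlgebraicClosure K) with hβ
  set j : K →ₐ[k] AlgebraicClosure k := closureCopy K with hj
  have hβ0 : β ≠ 0 := by
    rw [hβ]; exact (map_ne_zero_iff Ψ.symm Ψ.symm.injective).mpr α.ne_zero
  have hβsq : β ^ 2 = j (a : K) := by
    rw [hβ, ← map_pow, ← Units.val_pow_eq_pow_val, hα, kummerUnitsRoot_pow, Units.coe_map, MonoidHom.coe_coe,
      hj, closureCopy_apply]
  -- coset representatives and finiteness of `Γ_k / N`
  set s : G ⧸ N → G := Quotient.out with hsdef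
  have hs : ∀ x : G ⧸ N, (s x : G ⧸ N) = x := QuotientGroup.out_eq'
  have hinj := algHom_rep_injective (k := k) (K := K) hs
  haveI : Fintype (G ⧸ N) := @Fintype.ofFinite _ (Finite.of_injective _ hinj)
  -- the Klein structure of `E[2](k̄)` around `T = T_θ`, stabiliser `N`
  obtain ⟨T₂', T₃', hm2, hm3, h20, h30, h21, h31, h23, hadd, h22, hall⟩ := W.exists_geomTwoTorsion_eq_over hθ
  set T : geomTorsion W 2 := W.geomOneRootOverTorsion hθ with hT_def
  set T₂ : geomTorsion W 2 := ⟨T₂', hm2⟩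
  set T₃ : geomTorsion W 2 := ⟨T₃', hm3⟩
  have h0T : T ≠ 0 := fun h => W.geomOneRootOver_ne_zero hθ (congrArg Subtype.val h)
  have h02 : T₂ ≠ 0 := fun h => h20 (congrArg Subtype.val h)
  have h03 : T₃ ≠ 0 := fun h => h30 (congrArg Subtype.val h)
  have h12 : T ≠ T₂ := fun h => h21 (congrArg Subtype.val h).symm
  have h13 : T ≠ T₃ := fun h => h31 (congrArg Subtype.val h).symm
  have h23v : T₂ ≠ T₃ := fun h => h23 (congrArg Subtype.val h)
  have haddv : T + T₂ = T₃ := Subtype.ext hadd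
  have hTT : T + T = 0 := by
    apply Subtype.ext
    have := W.geomOneRootOver_mem hθ
    rw [mem_geomTorsion_iff, two_zsmul] at this
    exact this
  have h22v : T₂ + T₂ = 0 := Subtype.ext h22
  have hallv : ∀ v : geomTorsion W 2, v = 0 ∨ v = T ∨ v = T₂ ∨ v = T₃ := by
    intro v
    rcases hall v v.2 with h | h | h | h
    · exact Or.inl (Subtype.ext h)
    · exact Or.inr (Or.inl (Subtype.ext h))
    · exact Or.inr (Or.inr (Or.inl (Subtype.ext h)))
    · exact Or.inr (Or.inr (Or.inr (Subtype.ext h)))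
  have hfix := W.exists_smul_ne_of_irreducible hirr
  have hN : ∀ g : G, g ∈ N ↔ g • T = T := fun g => (W.smul_geomOneRootOverTorsion_eq_iff hirr h3 hθ g).symm
  -- (1) the transfer of `χ_T ∘ ξ|_N` vanishes, and (2) each factor is `(s(gx)⁻¹ g s(x))(β)/β`
  have hprod : ∀ g : G, ∏ x : G ⧸ N, ((s (g • x))⁻¹ * g * s x) • β / β = 1 := by
    intro g
    rw [← KleinCocycle.prod_sign_apply_schreier_eq_one h0T h02 h03 h12 h13 h23v haddv hTT h22v hallv hfix N hN
      hs (fun g => ξ.1 g) (fun g h => ξ.2 g h) (AlgebraicClosure k) g]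
    refine Finset.prod_congr rfl fun x _ => ?_
    have hmem : (s (g • x))⁻¹ * g * s x ∈ N := by
      rw [hN, mul_smul, mul_smul, ← KleinCocycle.smul_rep_smul N hN hs g x, inv_smul_smul]
    have hval : (if ξ.1 ((s (g • x))⁻¹ * g * s x) = 0 ∨
        ξ.1 ((s (g • x))⁻¹ * g * s x) = W.geomOneRootOverTorsion hθ then (1 : AlgebraicClosure k) else -1) =
        ((s (g • x))⁻¹ * g * s x) • β / β := W.sign_apply_eq_smul_div hθ ξ a ha hmem
    by_cases hc : ξ.1 ((s (g • x))⁻¹ * g * s x) = 0 ∨ ξ.1 ((s (g • x))⁻¹ * g * s x) = W.geomOneRootOverTorsion hθ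
    · rw [if_pos hc] at hval ⊢; exact hval.symm
    · rw [if_neg hc] at hval ⊢; exact hval.symm
  -- (3) `g(A) = A` for the norm element `A = ∏ s(x)(β)`
  set A : AlgebraicClosure k := ∏ x : G ⧸ N, s x • β with hA
  have hA0 : A ≠ 0 := by
    rw [hA]
    exact Finset.prod_ne_zero_iff.mpr fun x _ h0 => hβ0 (by
      have := congrArg (fun w => (s x)⁻¹ • w) h0
      simpa only [inv_smul_smul, smul_zero] using this)
  have hsign : ∀ g : G, ∀ x : G ⧸ N, ((s (g • x))⁻¹ * g * s x) • β / β = g • (s x • β) / (s (g • x) • β) := by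
    intro g x
    -- the factor is `±1`, hence fixed by `s(g x)`
    have hmem : (s (g • x))⁻¹ * g * s x ∈ N := by
      rw [hN, mul_smul, mul_smul, ← KleinCocycle.smul_rep_smul N hN hs g x, inv_smul_smul]
    have hval : (if ξ.1 ((s (g • x))⁻¹ * g * s x) = 0 ∨
        ξ.1 ((s (g • x))⁻¹ * g * s x) = W.geomOneRootOverTorsion hθ then (1 : AlgebraicClosure k) else -1) =
        ((s (g • x))⁻¹ * g * s x) • β / β := W.sign_apply_eq_smul_div hθ ξ a ha hmem
    have hfixed : s (g • x) • (((s (g • x))⁻¹ * g * s x) • β / β) = ((s (g • x))⁻¹ * g * s x) • β / β := by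
      rw [← hval]
      split_ifs
      · exact smul_one _
      · rw [smul_neg, smul_one]
    rw [← hfixed, div_eq_mul_inv, smul_mul', smul_inv'', ← mul_smul,
      show s (g • x) * ((s (g • x))⁻¹ * g * s x) = g * s x by group, mul_smul, div_eq_mul_inv]
  have hfixA : ∀ g : G, g • A = A := by
    intro g
    have h1 := hprod g
    rw [Finset.prod_congr rfl fun x _ => hsign g x, Finset.prod_div_distrib] at h1
    have hnum : ∏ x : G ⧸ N, g • (s x • β) = g • A := by rw [hA, Finset.smul_prod']
    have hden : ∏ x : G ⧸ N, s (g • x) • β = A := Equiv.prod_comp (MulAction.toPerm g) (fun y => s y • β)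
    rw [hnum, hden, div_eq_one_iff_eq hA0] at h1
    exact h1
  -- (4) `A ∈ k`
  haveI : ExpChar k 1 := ExpChar.zero
  obtain ⟨m, b, hb⟩ := absoluteGaloisGroup.exists_algebraMap_eq_pow_of_forall_smul_eq k 1 hfixA
  rw [one_pow, pow_one] at hb
  -- (5) `A² = ∏ s(x)(j a) = N_{K/k}(a)`
  have hA2 : A ^ 2 = ∏ x : G ⧸ N, s x • j (a : K) := by
    rw [hA, ← Finset.prod_pow]
    exact Finset.prod_congr rfl fun x _ => by rw [← hβsq]; exact (smul_pow' (s x) β 2).symm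
  have hcard : Fintype.card (G ⧸ N) = Fintype.card (K →ₐ[k] AlgebraicClosure k) := by
    -- both are `3`: the orbit of `T` has `3` elements, and `#(K → k̄) = [K : k]`
    have h3' : Fintype.card (G ⧸ N) = 3 := by
      have := KleinCocycle.prod_orbit_eq N hN hs h0T h02 h03 h12 h13 h23v haddv hTT hallv hfix
        (M := Multiplicative ℕ) (fun _ => Multiplicative.ofAdd 1)
      rw [Finset.prod_const, Finset.card_univ] at this
      have h' := congrArg Multiplicative.toAdd this
      simp only [toAdd_pow, toAdd_mul, toAdd_ofAdd, smul_eq_mul, mul_one] at h'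
      omega
    rw [h3', AlgHom.card k K (AlgebraicClosure k), h3]
  have hbij : Function.Bijective fun x : G ⧸ N =>
      ((show AlgebraicClosure k ≃ₐ[k] AlgebraicClosure k from s x) :
        AlgebraicClosure k →ₐ[k] AlgebraicClosure k).comp j :=
    (Fintype.bijective_iff_injective_and_card _).mpr ⟨hinj, hcard⟩
  have hnorm : algebraMap k (AlgebraicClosure k) (Algebra.norm k (a : K)) = A ^ 2 := by
    rw [Algebra.norm_eq_prod_embeddings k (AlgebraicClosure k) (a : K), hA2]
    exact (Fintype.prod_bijective _ hbij (fun x => s x • j (a : K)) (fun σ => σ (a : K)) fun x => rfl).symm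
  -- (6) conclude
  refine ⟨b, (algebraMap k (AlgebraicClosure k)).injective ?_⟩
  rw [map_mul, hb, hnorm, sq]

end WeierstrassCurve

end
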